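import Literature.NumberTheory.Automorphic.CDTTheorem722ThreeFactsProofs
import Literature.NumberTheory.Automorphic.CDTTheorem712ConductorStepProofs
import HarnessLib

/-!
# CDT Theorem 7.1.2 from the two modularity lifting statements of its printed proof

Topic `NumberTheory/Automorphic`; a third `…Proofs` companion (theorems only: no definitions, no
named facts, no instances, no `sorry`) of `Literature.NumberTheory.Automorphic.BCDTModularity`
for the named fact `Literature.NumberTheory.Automorphic.BCDT.CDT_theorem_7_1_2`
(Conrad–Diamond–Taylor 1999, Thm. 7.1.2: *"Let `E/ℚ` be an elliptic curve whose conductor is not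
divisible by `27`. Then `E` is modular"*, J. Amer. Math. Soc. 12 (1999), p. 551), landed by its
tenured seat after `CDTTheorem712OggThreeProofs` and `CDTTheorem712ConductorStepProofs`.

`CDTTheorem712ConductorStepProofs` proves Theorem 7.1.2 from **exactly the four deep results its
printed proof (p. 556) invokes** — `CDT_theorem_7_1_2_of_CDT721_722_723_switch : CDT_theorem_7_2_1 →
CDT_theorem_7_2_2 → CDT_lemma_7_2_3_isModular → CDT_three_five_switch → CDT_theorem_7_1_2` — every
glue step (the conductor transfer `27 ∤ N_E ⇒ 27 ∤ N_{E'}` along `E'[5] ≅ E[5]`, Ogg's formula at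
`p = 3`, "`E'` modular ⇒ `ρ̄_{E,5}` modular") being a theorem of the tree.  Two of those four named
facts are themselves one printed paragraph each on top of CDT's **Theorem 7.1.1** (= Thm. 5.4.2,
`R = T` for potentially Barsotti–Tate deformations, combined with Diamond 1996 [12, Thm. 5.3]):

* **Theorem 7.2.2** (p. 553): *"Let `E/ℚ` be an elliptic curve such that `ρ̄_{E,5}|_{ℚ(√5)}` is
  absolutely irreducible. If `ρ̄_{E,5}` is modular, then `E` is modular."*  The seat of that fact
  has reduced it (`CDTTheorem722`, `CDTTheorem722Proofs`, `CDTTheorem722ThreeFactsProofs`: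
  `CDT_theorem_7_2_2_iff_lift_of_three_facts`) to the **`5`-adic lifting statement** `lift₅` of
  pp. 553–554 — *`ρ̄_{E,5}|_{ℚ(√5)}` absolutely irreducible and `ρ̄_{E,5}` modular ⇒ `ρ_{E,5}`
  modular* (`WeierstrassCurve.IsModularGaloisRepTate 5`) — granted three catalogued classical facts,
  Eichler–Shimura (`eichlerShimuraConstruction`), Faltings (`WeierstrassCurve.isIsogenous_iff_frobeniusTrace_eq`)
  and Carayol (`IsNewformOf.level_eq_conductorNorm`), which give BCDT's "(3) ⇒ (2)"
  (`isModular_of_isModularGaloisRepTate_of_three_facts`, every prime `ℓ`).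
* **Theorem 7.2.1** (p. 553): *"Let `E/ℚ` be an elliptic curve such that `ρ̄_{E,3}|_{ℚ(√-3)}` is
  absolutely irreducible. If the conductor of `E` is not divisible by `27`, then `E` is modular.
  Proof. Recall that the modularity of `ρ̄ = ρ̄_{E,3}` follows from results of Langlands and
  Tunnell. If `E` has a quadratic twist with semistable reduction over `ℚ₃`, then `E` is modular
  by Theorem 5.4 of [12], so suppose this is not the case. Since we assume the conductor of `E` is
  not divisible by `27` (so the 'wild' part of the conductor at `3` is trivial), Lemma 7.1.3 shows
  that `E` acquires good supersingular reduction over any extension `L` of `ℚ₃` with `e(L) = 4`,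
  but not over any extension with `e(L) = 2`. It follows from §B.2 and Proposition B.4.2 that
  `τ = WD(ρ)|_{I₃}` has the form `ω̃₂² ⊕ ω̃₂⁶`, where `ρ = ρ_{E,3}`. We now claim that the
  centralizer of `ρ̄|_{G₃}` consists only of scalars and that `WD(ρ)|_{I₃}` is strongly acceptable
  for `ρ̄` … [Cor. 2.3.2; [6, Thm. 4.2.2]]"* — whereupon Theorem 7.1.1 makes `ρ = ρ_{E,3}`
  modular, and `E` is modular by (3) ⇒ (2).

This file does for Theorem 7.2.1 what `CDTTheorem722*` did for Theorem 7.2.2, and feeds both into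
the assembly of Theorem 7.1.2.  The first sentence of the printed proof is a THEOREM of the tree
granted the named fact `langlands_tunnell` (lang.S30):
`WeierstrassCurve.isModular_of_isTorsionGaloisRep_three_of_langlands_tunnell`
(`LanglandsTunnellModThree`; Wiles 1995, Ch. 5; Gelbart 1997, Prop. 1.4, Steps 1–3) — for `E / ℚ`
with `E[3]` absolutely irreducible, `ρ̄_{E,3}` is modular (`ModPGaloisRep.IsModular`).  The rest of
the paragraph is the **`3`-adic lifting statement** `lift₃`, carried here, like `lift₅`, as an
explicit hypothesis in the conventions of `CDT_theorem_7_2_1` (`BCDTTheoremB`): for every elliptic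
`W / ℚ` and every framed model `ρ̄` of `E[3]` (`W.IsTorsionGaloisRep 3 ρ̄`),

  `ρ̄|_{ℚ(√-3)}` absolutely irreducible → `27 ∤ N_E` → `ρ̄` modular → `ρ_{E,3}` modular
  (`W.IsModularGaloisRepTate 3`),

i.e. Theorem 7.1.1 at `ℓ = 3` specialised to `ρ = ρ_{E,3}` with its local hypotheses discharged
by `27 ∤ N_E` as printed (Lemma 7.1.3, §B.2, Prop. B.4.2, Cor. 2.3.2), together with [12, Thm. 5.4]
in the twist-semistable case (whose printed conclusion "`E` is modular" yields "`ρ_{E,3}` is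
modular" by the tree's theorem (2) ⇒ (4), `IsModular.isModularGaloisRepTate`).  Nothing in this
file claims `lift₃` or `lift₅`: they are the part of [CDT] that needs the `p`-adic Hodge theory
(Weil–Deligne types, potentially Barsotti–Tate representations, acceptability) and the deformation
theory (`R = T`) absent from Mathlib and from the tree.

## Main statements (all in namespace `Literature.NumberTheory.Automorphic.BCDT`)

* `CDT_theorem_7_2_1_of_modThree_of_lift_of_three_imp_two` — **Theorem 7.2.1 by its printed
  architecture**: from (a) "`E[3]` absolutely irreducible ⇒ `ρ̄_{E,3}` modular", (b) `lift₃`,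
  (c) (3) ⇒ (2) at `ℓ = 3`; `lift_three_of_CDT_theorem_7_2_1` — conversely the named fact implies
  `lift₃` (by (2) ⇒ (4)); `CDT_theorem_7_2_1_iff_lift_three` — granted (a) and (c), the named fact
  `CDT_theorem_7_2_1` is EQUIVALENT to `lift₃`.
* `three_imp_two_at_three_of_three_facts` — (c) from Eichler–Shimura, Faltings, Carayol
  (`isModular_of_isModularGaloisRepTate_of_three_facts` at `ℓ = 3`);
  `CDT_theorem_7_2_1_of_langlands_tunnell_of_lift_of_three_facts`,
  `CDT_theorem_7_2_1_iff_lift_of_langlands_tunnell_of_three_facts` — **granted Langlands–Tunnell,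
  Eichler–Shimura, Faltings and Carayol, `CDT_theorem_7_2_1` is equivalent to the `3`-adic lifting
  statement of p. 553.**
* `CDT_theorem_7_1_2_of_modThree_of_lifts_of_three_imp_two_of_7_2_3_of_switch` and
  **`CDT_theorem_7_1_2_of_langlands_tunnell_of_lifts_of_7_2_3_of_switch_of_three_facts`** —
  **Theorem 7.1.2 from the two lifting statements `lift₃`, `lift₅` (Theorem 7.1.1 at `ℓ = 3` and
  at `ℓ = 5`), Langlands–Tunnell, Lemma 7.2.3 (Elkies), the `3`–`5` switch, and Eichler–Shimura,
  Faltings, Carayol**; `…_of_auxiliaryCurve_of_three_facts` — the switch supplied by the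
  Shepherd-Barron–Taylor auxiliary curve (`exists_isTorsionGaloisRep_five_and_surjective_three`);
  `CDT_theorem_7_1_2_iff_lift_three_of_langlands_tunnell_of_lift_five_of_7_2_3_of_switch_of_three_facts`
  — granted the other inputs, **`CDT_theorem_7_1_2` is equivalent to `lift₃`**.
* Downstream, one line each: `CDT_theorem_7_2_4_of_langlands_tunnell_of_lifts_of_7_2_3_of_switch_of_three_facts`
  (CDT Thm. 7.2.4), `theoremB_of_wild_auxiliaryCurve_langlands_tunnell_lift_three_facts` (BCDT
  Theorem B from its wild case, the auxiliary curve, Langlands–Tunnell, `lift₃` and the three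
  facts), `exists_isNewformOf_of_wild_auxiliaryCurve_langlands_tunnell_lifts_723_three_facts`
  (BCDT Theorem A = the Modularity Theorem `exists_isNewformOf`) and
  `exists_cuspForm_coeff_eq_frobeniusTrace_of_wild_auxiliaryCurve_langlands_tunnell_lifts_723_three_facts`
  (lang.S33).

Trust base of `CDT_theorem_7_1_2` inside the tree after this file: the catalogued named facts
{`langlands_tunnell`, `CDT_lemma_7_2_3_isModular`, `CDT_three_five_switch` (or
`exists_isTorsionGaloisRep_five_and_surjective_three`), `eichlerShimuraConstruction`,
`WeierstrassCurve.isIsogenous_iff_frobeniusTrace_eq`, `IsNewformOf.level_eq_conductorNorm`} plus the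
two printed lifting statements `lift₃` (Thm. 7.2.1, proof, p. 553) and `lift₅` (Thm. 7.2.2, proof,
pp. 553–554) — the two applications of Theorem 7.1.1 that are the new content of [CDT] §7.  For
the Modularity Theorem along the CDT–BCDT route: the same with the switch replaced by the
auxiliary curve, plus the wild case of BCDT Thm. 2.2.1
(`exists_isTorsionGaloisRep_and_isModular_of_not_isTamelyRamifiedAbove`).

## References

* [ConradDiamondTaylor1999] B. Conrad, F. Diamond, R. Taylor, *Modularity of certain potentially
  Barsotti–Tate Galois representations*, J. Amer. Math. Soc. 12 (1999), 521–567: Thm. 7.1.1 and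
  Thm. 7.1.2 (p. 551), Lemma 7.1.3 (p. 552), Thm. 7.2.1 with its proof and Thm. 7.2.2 (p. 553),
  proof of Thm. 7.1.2 (p. 556).
* [BCDTJAMS2001] C. Breuil, B. Conrad, F. Diamond, R. Taylor, *On the modularity of elliptic
  curves over `ℚ`: wild `3`-adic exercises*, J. Amer. Math. Soc. 14 (2001), Introduction
  (conditions (1)–(4), "(3) ⇒ (2) follows from a theorem of Carayol [Ca1] and a theorem of
  Faltings [Fa2]"), §2.2 (proof of Thm. 2.2.1).
* [Diamond1996] F. Diamond, *On deformation rings and Hecke rings*, Ann. of Math. 144 (1996),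
  Thms. 5.3, 5.4 (= [12] of [CDT]).
* [Wiles1995Annals] A. Wiles, Ann. of Math. 141 (1995), Ch. 5; [Gelbart1997] S. Gelbart, in
  *Modular Forms and Fermat's Last Theorem* (1997), Prop. 1.4.

## Design

Theorems only; `noncomputable section`; namespace `Literature.NumberTheory.Automorphic.BCDT` (and
`Literature.NumberTheory.Automorphic` for the lang.S33 corollary).  The lifting statements are
hypotheses of theorems, never definitions: no named fact is introduced (D-0026), and
`CDT_theorem_7_1_2_holds` is NOT claimed.  Axioms of every theorem: `propext`, `Classical.choice`,
`Quot.sound`.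
-/

noncomputable section

open scoped MatrixGroups

namespace Literature.NumberTheory.Automorphic.BCDT

open WeierstrassCurve GaloisRepresentations EllipticCurves EllipticCurves.ModularForms

/-! ## CDT Theorem 7.2.1 versus its `3`-adic lifting statement -/

/-- **Conrad–Diamond–Taylor 1999, Theorem 7.2.1 by its printed architecture** (p. 553: "Recall
that the modularity of `ρ̄ = ρ̄_{E,3}` follows from results of Langlands and Tunnell. If `E` has a
quadratic twist with semistable reduction over `ℚ₃`, then `E` is modular by Theorem 5.4 of [12] …
[otherwise `τ = WD(ρ)|_{I₃} = ω̃₂² ⊕ ω̃₂⁶` is strongly acceptable and Theorem 7.1.1 applies to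
`ρ = ρ_{E,3}`]").  Hypotheses, spelled out: `hmod3` — for every elliptic `W / ℚ` and framed model
`ρ̄` of `E[3]`, `ρ̄` absolutely irreducible implies `ρ̄` modular (Langlands–Tunnell, Wiles Ch. 5;
the tree's `WeierstrassCurve.isModular_of_isTorsionGaloisRep_three_of_langlands_tunnell`); `hlift` —
the `3`-adic lifting statement: `ρ̄|_{ℚ(√-3)}` absolutely irreducible, `27 ∤ N_E` and `ρ̄` modular
imply `ρ_{E,3}` modular (`W.IsModularGaloisRepTate 3`; Thm. 7.1.1 at `ℓ = 3` with Lemma 7.1.3,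
§B.2, Prop. B.4.2, Cor. 2.3.2, resp. [12, Thm. 5.4]); `h32` — (3) ⇒ (2) at `ℓ = 3`: `ρ_{E,3}`
modular implies `E` modular (Faltings, Carayol).  Conclusion: the named fact `CDT_theorem_7_2_1`
of `BCDTTheoremB`, conventions word for word as there (`ρ̄|_{ℚ(√-3)}` absolutely irreducible makes
`ρ̄` absolutely irreducible, `ModPGaloisRep.IsAbsIrreducibleOverSqrt.isAbsolutelyIrreducible`).
[cite: ConradDiamondTaylor1999, Thm. 7.2.1 (proof, p. 553)] -/
theorem CDT_theorem_7_2_1_of_modThree_of_lift_of_three_imp_two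
    (hmod3 : ∀ (W : WeierstrassCurve ℚ) [W.IsElliptic] (ρ : ModPGaloisRep ℚ (ZMod 3) 2),
      W.IsTorsionGaloisRep 3 ρ → FramedRep.IsAbsolutelyIrreducible ρ → ρ.IsModular)
    (hlift : ∀ (W : WeierstrassCurve ℚ) [W.IsElliptic] (ρ : ModPGaloisRep ℚ (ZMod 3) 2),
      W.IsTorsionGaloisRep 3 ρ → ρ.IsAbsIrreducibleOverSqrt (-3) → ¬ 27 ∣ W.conductorNorm ℤ →
      ρ.IsModular → W.IsModularGaloisRepTate 3)
    (h32 : ∀ (W : WeierstrassCurve ℚ) [W.IsElliptic] [NeZero (W.conductorNorm ℤ)],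
      W.IsModularGaloisRepTate 3 → IsModular W) :
    CDT_theorem_7_2_1 :=
  fun W _ _ ρ hρ hirr h27 ↦ h32 W (hlift W ρ hρ hirr h27 (hmod3 W ρ hρ hirr.isAbsolutelyIrreducible))

/-- **The accepted `CDT_theorem_7_2_1` implies the `3`-adic lifting statement**, by the proved
(2) ⇒ (4) (`IsModular.isModularGaloisRepTate` at `ℓ = 3`): for every elliptic `W / ℚ` and framed
model `ρ̄` of `E[3]`, `ρ̄|_{ℚ(√-3)}` absolutely irreducible and `27 ∤ N_E` already imply `ρ_{E,3}`
modular (the hypothesis "`ρ̄` modular" of `lift₃` is not even needed).  So `lift₃` is not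
stronger, inside the tree, than the named fact it decomposes. [folklore] -/
theorem lift_three_of_CDT_theorem_7_2_1 (h : CDT_theorem_7_2_1) (W : WeierstrassCurve ℚ)
    [W.IsElliptic] (ρ : ModPGaloisRep ℚ (ZMod 3) 2) (hρ : W.IsTorsionGaloisRep 3 ρ)
    (hirr : ρ.IsAbsIrreducibleOverSqrt (-3)) (h27 : ¬ 27 ∣ W.conductorNorm ℤ) :
    W.IsModularGaloisRepTate 3 := by
  haveI : NeZero (W.conductorNorm ℤ) := ⟨(conductorNorm_pos_holds W).ne'⟩
  exact (h W ρ hρ hirr h27).isModularGaloisRepTate 3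

/-- **Inside the tree, CDT Theorem 7.2.1 is equivalent to its `3`-adic lifting statement,
granted "`E[3]` absolutely irreducible ⇒ `ρ̄_{E,3}` modular" (Langlands–Tunnell) and (3) ⇒ (2)
at `ℓ = 3`** (`CDT_theorem_7_2_1_of_modThree_of_lift_of_three_imp_two` and
`lift_three_of_CDT_theorem_7_2_1`): what the named fact `CDT_theorem_7_2_1` asserts beyond those
two inputs is exactly the application of Theorem 7.1.1 at `ℓ = 3` printed on p. 553.
[cite: ConradDiamondTaylor1999, Thm. 7.2.1 (proof, p. 553)] -/
theorem CDT_theorem_7_2_1_iff_lift_three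
    (hmod3 : ∀ (W : WeierstrassCurve ℚ) [W.IsElliptic] (ρ : ModPGaloisRep ℚ (ZMod 3) 2),
      W.IsTorsionGaloisRep 3 ρ → FramedRep.IsAbsolutelyIrreducible ρ → ρ.IsModular)
    (h32 : ∀ (W : WeierstrassCurve ℚ) [W.IsElliptic] [NeZero (W.conductorNorm ℤ)],
      W.IsModularGaloisRepTate 3 → IsModular W) :
    CDT_theorem_7_2_1 ↔
      ∀ (W : WeierstrassCurve ℚ) [W.IsElliptic] (ρ : ModPGaloisRep ℚ (ZMod 3) 2),
        W.IsTorsionGaloisRep 3 ρ → ρ.IsAbsIrreducibleOverSqrt (-3) → ¬ 27 ∣ W.conductorNorm ℤ →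
        ρ.IsModular → W.IsModularGaloisRepTate 3 :=
  ⟨fun h W _ ρ hρ hirr h27 _ ↦ lift_three_of_CDT_theorem_7_2_1 h W ρ hρ hirr h27,
    fun h ↦ CDT_theorem_7_2_1_of_modThree_of_lift_of_three_imp_two hmod3 h h32⟩

/-! ## The same, with Langlands–Tunnell and (3) ⇒ (2) supplied by named facts of the tree -/

/-- **"The modularity of `ρ̄ = ρ̄_{E,3}` follows from results of Langlands and Tunnell"** (CDT,
proof of Thm. 7.2.1, first sentence; BCDT §2.2, p. 862) in the shape of the hypothesis `hmod3`
above: granted the tree's named fact `langlands_tunnell` (for every `σ : Γ_ℚ → GL₂(ℂ)`), for every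
elliptic `W / ℚ` and framed model `ρ̄` of `E[3]`, `ρ̄` absolutely irreducible implies `ρ̄` modular
— the tree's theorem `WeierstrassCurve.isModular_of_isTorsionGaloisRep_three_of_langlands_tunnell`
(`LanglandsTunnellModThree`: the lift `GL₂(𝔽₃) ↪ GL₂(ℤ[√-2])`, oddness from `det ρ̄_{E,3} = χ̄₃`).
[cite: Wiles1995Annals, Ch. 5] [cite: ConradDiamondTaylor1999, Thm. 7.2.1 (proof, p. 553)] -/
theorem modThree_of_langlands_tunnell (hLT : ∀ σ : FramedArtinRep ℚ 2, langlands_tunnell σ) :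
    ∀ (W : WeierstrassCurve ℚ) [W.IsElliptic] (ρ : ModPGaloisRep ℚ (ZMod 3) 2),
      W.IsTorsionGaloisRep 3 ρ → FramedRep.IsAbsolutelyIrreducible ρ → ρ.IsModular :=
  fun W _ ρ hρ habs ↦ W.isModular_of_isTorsionGaloisRep_three_of_langlands_tunnell hLT ρ hρ habs

/-- **(3) ⇒ (2) at `ℓ = 3`**, the hypothesis `h32` above, from Eichler–Shimura, Faltings and
Carayol (`isModular_of_isModularGaloisRepTate_of_three_facts` of `CDTTheorem722ThreeFactsProofs` at
the prime `3`). [cite: BCDTJAMS2001, Introduction ((3) ⇒ (2))] -/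
theorem three_imp_two_at_three_of_three_facts
    (hES : eichlerShimuraConstruction)
    (hF : WeierstrassCurve.isIsogenous_iff_frobeniusTrace_eq)
    (hC : ∀ (N : ℕ) [NeZero N], IsNewformOf.level_eq_conductorNorm (N := N)) :
    ∀ (W : WeierstrassCurve ℚ) [W.IsElliptic] [NeZero (W.conductorNorm ℤ)],
      W.IsModularGaloisRepTate 3 → IsModular W :=
  fun W _ _ h ↦ isModular_of_isModularGaloisRepTate_of_three_facts hES hF hC W 3 h

/-- **Conrad–Diamond–Taylor 1999, Theorem 7.2.1 from its `3`-adic lifting statement, granted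
Langlands–Tunnell, Eichler–Shimura, Faltings and Carayol**: the `3`-adic lifting statement of
p. 553 (`hlift`: for every elliptic `W / ℚ` and framed model `ρ̄` of `E[3]`, `ρ̄|_{ℚ(√-3)}`
absolutely irreducible, `27 ∤ N_E` and `ρ̄` modular imply `ρ_{E,3}` modular; there from Thm. 7.1.1
at `ℓ = 3`, resp. [12, Thm. 5.4]) implies the named fact `CDT_theorem_7_2_1`
(`CDT_theorem_7_2_1_of_modThree_of_lift_of_three_imp_two` with `modThree_of_langlands_tunnell` and
`three_imp_two_at_three_of_three_facts`). [cite: ConradDiamondTaylor1999, Thm. 7.2.1 (proof, p. 553)] -/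
theorem CDT_theorem_7_2_1_of_langlands_tunnell_of_lift_of_three_facts
    (hLT : ∀ σ : FramedArtinRep ℚ 2, langlands_tunnell σ)
    (hES : eichlerShimuraConstruction)
    (hF : WeierstrassCurve.isIsogenous_iff_frobeniusTrace_eq)
    (hC : ∀ (N : ℕ) [NeZero N], IsNewformOf.level_eq_conductorNorm (N := N))
    (hlift : ∀ (W : WeierstrassCurve ℚ) [W.IsElliptic] (ρ : ModPGaloisRep ℚ (ZMod 3) 2),
      W.IsTorsionGaloisRep 3 ρ → ρ.IsAbsIrreducibleOverSqrt (-3) → ¬ 27 ∣ W.conductorNorm ℤ →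
      ρ.IsModular → W.IsModularGaloisRepTate 3) :
    CDT_theorem_7_2_1 :=
  CDT_theorem_7_2_1_of_modThree_of_lift_of_three_imp_two (modThree_of_langlands_tunnell hLT) hlift
    (three_imp_two_at_three_of_three_facts hES hF hC)

/-- **Inside the tree, CDT Theorem 7.2.1 is equivalent to its `3`-adic (Galois-theoretic) form,
granted only Langlands–Tunnell, Eichler–Shimura, Faltings and Carayol**: what the named fact
`CDT_theorem_7_2_1` asserts beyond those four catalogued facts is exactly the application of
Theorem 7.1.1 (with [12, Thm. 5.4]) at `ℓ = 3` printed on p. 553 (`CDT_theorem_7_2_1_iff_lift_three`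
with `modThree_of_langlands_tunnell` and `three_imp_two_at_three_of_three_facts`).
[cite: ConradDiamondTaylor1999, Thm. 7.2.1 (proof, p. 553)] -/
theorem CDT_theorem_7_2_1_iff_lift_of_langlands_tunnell_of_three_facts
    (hLT : ∀ σ : FramedArtinRep ℚ 2, langlands_tunnell σ)
    (hES : eichlerShimuraConstruction)
    (hF : WeierstrassCurve.isIsogenous_iff_frobeniusTrace_eq)
    (hC : ∀ (N : ℕ) [NeZero N], IsNewformOf.level_eq_conductorNorm (N := N)) :
    CDT_theorem_7_2_1 ↔
      ∀ (W : WeierstrassCurve ℚ) [W.IsElliptic] (ρ : ModPGaloisRep ℚ (ZMod 3) 2),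
        W.IsTorsionGaloisRep 3 ρ → ρ.IsAbsIrreducibleOverSqrt (-3) → ¬ 27 ∣ W.conductorNorm ℤ →
        ρ.IsModular → W.IsModularGaloisRepTate 3 :=
  CDT_theorem_7_2_1_iff_lift_three (modThree_of_langlands_tunnell hLT)
    (three_imp_two_at_three_of_three_facts hES hF hC)

/-! ## CDT Theorem 7.1.2 from the two lifting statements -/

/-- **Conrad–Diamond–Taylor 1999, Theorem 7.1.2 from the two applications of Theorem 7.1.1 —
abstract form.**  Granted (a) "`E[3]` absolutely irreducible ⇒ `ρ̄_{E,3}` modular"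
(Langlands–Tunnell), (b) the `3`-adic lifting statement `lift₃` (Thm. 7.2.1, proof, p. 553),
(c) the `5`-adic lifting statement `lift₅` (Thm. 7.2.2, proof, pp. 553–554), (d) (3) ⇒ (2) at
`ℓ = 3` and at `ℓ = 5` (Faltings, Carayol), (e) the modularity conclusion of Lemma 7.2.3 (Elkies)
and (f) the `3`–`5` switch (p. 556), every elliptic curve over `ℚ` with `27 ∤ N_E` is modular:
`CDT_theorem_7_1_2_of_CDT721_722_723_switch` (`CDTTheorem712ConductorStepProofs`, the printed proof
on p. 556 with the conductor transfer proved) with Thm. 7.2.1 from (a), (b), (d)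
(`CDT_theorem_7_2_1_of_modThree_of_lift_of_three_imp_two`) and Thm. 7.2.2 from (c), (d)
(`CDT_theorem_7_2_2_of_lift_of_three_imp_two`, `CDTTheorem722`).
[cite: ConradDiamondTaylor1999, Thm. 7.1.2 (proof, pp. 553–556)] -/
theorem CDT_theorem_7_1_2_of_modThree_of_lifts_of_three_imp_two_of_7_2_3_of_switch
    (hmod3 : ∀ (W : WeierstrassCurve ℚ) [W.IsElliptic] (ρ : ModPGaloisRep ℚ (ZMod 3) 2),
      W.IsTorsionGaloisRep 3 ρ → FramedRep.IsAbsolutelyIrreducible ρ → ρ.IsModular)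
    (hlift3 : ∀ (W : WeierstrassCurve ℚ) [W.IsElliptic] (ρ : ModPGaloisRep ℚ (ZMod 3) 2),
      W.IsTorsionGaloisRep 3 ρ → ρ.IsAbsIrreducibleOverSqrt (-3) → ¬ 27 ∣ W.conductorNorm ℤ →
      ρ.IsModular → W.IsModularGaloisRepTate 3)
    (hlift5 : ∀ (W : WeierstrassCurve ℚ) [W.IsElliptic] (ρ : ModPGaloisRep ℚ (ZMod 5) 2),
      W.IsTorsionGaloisRep 5 ρ → ρ.IsAbsIrreducibleOverSqrt 5 → ρ.IsModular →
      W.IsModularGaloisRepTate 5)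
    (h32three : ∀ (W : WeierstrassCurve ℚ) [W.IsElliptic] [NeZero (W.conductorNorm ℤ)],
      W.IsModularGaloisRepTate 3 → IsModular W)
    (h32five : ∀ (W : WeierstrassCurve ℚ) [W.IsElliptic] [NeZero (W.conductorNorm ℤ)],
      W.IsModularGaloisRepTate 5 → IsModular W)
    (h723 : CDT_lemma_7_2_3_isModular) (hsw : CDT_three_five_switch) : CDT_theorem_7_1_2 :=
  CDT_theorem_7_1_2_of_CDT721_722_723_switch
    (CDT_theorem_7_2_1_of_modThree_of_lift_of_three_imp_two hmod3 hlift3 h32three)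
    (CDT_theorem_7_2_2_of_lift_of_three_imp_two hlift5 h32five) h723 hsw

/-- **Conrad–Diamond–Taylor 1999, Theorem 7.1.2 from the two lifting statements of its printed
proof, granted the catalogued classical results it invokes — Langlands–Tunnell, Lemma 7.2.3
(Elkies), the `3`–`5` switch, Eichler–Shimura, Faltings, Carayol.**  Hypotheses: the named facts
`langlands_tunnell` (every `σ`), `eichlerShimuraConstruction`,
`WeierstrassCurve.isIsogenous_iff_frobeniusTrace_eq`, `IsNewformOf.level_eq_conductorNorm` (every
level), `CDT_lemma_7_2_3_isModular`, `CDT_three_five_switch`, and the two printed applications of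
Theorem 7.1.1: `hlift3` (Thm. 7.2.1, proof, p. 553: `ρ̄_{E,3}|_{ℚ(√-3)}` absolutely irreducible,
`27 ∤ N_E`, `ρ̄_{E,3}` modular ⇒ `ρ_{E,3}` modular) and `hlift5` (Thm. 7.2.2, proof, pp. 553–554:
`ρ̄_{E,5}|_{ℚ(√5)}` absolutely irreducible, `ρ̄_{E,5}` modular ⇒ `ρ_{E,5}` modular).  Conclusion:
the named fact `CDT_theorem_7_1_2` — so that, inside the tree, Theorem 7.1.2 rests on exactly the
two `R = T` lifting statements that are the new content of [CDT] §7 plus catalogued facts.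
[cite: ConradDiamondTaylor1999, Thm. 7.1.2 (proof, pp. 553–556)] -/
theorem CDT_theorem_7_1_2_of_langlands_tunnell_of_lifts_of_7_2_3_of_switch_of_three_facts
    (hLT : ∀ σ : FramedArtinRep ℚ 2, langlands_tunnell σ)
    (hES : eichlerShimuraConstruction)
    (hF : WeierstrassCurve.isIsogenous_iff_frobeniusTrace_eq)
    (hC : ∀ (N : ℕ) [NeZero N], IsNewformOf.level_eq_conductorNorm (N := N))
    (hlift3 : ∀ (W : WeierstrassCurve ℚ) [W.IsElliptic] (ρ : ModPGaloisRep ℚ (ZMod 3) 2),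
      W.IsTorsionGaloisRep 3 ρ → ρ.IsAbsIrreducibleOverSqrt (-3) → ¬ 27 ∣ W.conductorNorm ℤ →
      ρ.IsModular → W.IsModularGaloisRepTate 3)
    (hlift5 : ∀ (W : WeierstrassCurve ℚ) [W.IsElliptic] (ρ : ModPGaloisRep ℚ (ZMod 5) 2),
      W.IsTorsionGaloisRep 5 ρ → ρ.IsAbsIrreducibleOverSqrt 5 → ρ.IsModular →
      W.IsModularGaloisRepTate 5)
    (h723 : CDT_lemma_7_2_3_isModular) (hsw : CDT_three_five_switch) : CDT_theorem_7_1_2 :=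
  CDT_theorem_7_1_2_of_CDT721_722_723_switch
    (CDT_theorem_7_2_1_of_langlands_tunnell_of_lift_of_three_facts hLT hES hF hC hlift3)
    (CDT_theorem_7_2_2_of_lift_of_three_facts hES hF hC hlift5) h723 hsw

/-- **Theorem 7.1.2 from the two lifting statements, with the `3`–`5` switch supplied by the
Shepherd-Barron–Taylor auxiliary curve** (`exists_isTorsionGaloisRep_five_and_surjective_three`,
`BCDTTheoremB`; it implies `CDT_three_five_switch` by
`CDT_three_five_switch_of_exists_isTorsionGaloisRep_five_and_surjective_three`, `CDTTheorem712`):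
`CDT_theorem_7_1_2_of_CDT721_722_723_auxiliaryCurve` with Thms. 7.2.1, 7.2.2 unfolded as above.
[cite: ConradDiamondTaylor1999, Thm. 7.1.2 (proof, pp. 553–556)] -/
theorem CDT_theorem_7_1_2_of_langlands_tunnell_of_lifts_of_7_2_3_of_auxiliaryCurve_of_three_facts
    (hLT : ∀ σ : FramedArtinRep ℚ 2, langlands_tunnell σ)
    (hES : eichlerShimuraConstruction)
    (hF : WeierstrassCurve.isIsogenous_iff_frobeniusTrace_eq)
    (hC : ∀ (N : ℕ) [NeZero N], IsNewformOf.level_eq_conductorNorm (N := N))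
    (hlift3 : ∀ (W : WeierstrassCurve ℚ) [W.IsElliptic] (ρ : ModPGaloisRep ℚ (ZMod 3) 2),
      W.IsTorsionGaloisRep 3 ρ → ρ.IsAbsIrreducibleOverSqrt (-3) → ¬ 27 ∣ W.conductorNorm ℤ →
      ρ.IsModular → W.IsModularGaloisRepTate 3)
    (hlift5 : ∀ (W : WeierstrassCurve ℚ) [W.IsElliptic] (ρ : ModPGaloisRep ℚ (ZMod 5) 2),
      W.IsTorsionGaloisRep 5 ρ → ρ.IsAbsIrreducibleOverSqrt 5 → ρ.IsModular →
      W.IsModularGaloisRepTate 5)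
    (h723 : CDT_lemma_7_2_3_isModular) (hE : exists_isTorsionGaloisRep_five_and_surjective_three) :
    CDT_theorem_7_1_2 :=
  CDT_theorem_7_1_2_of_CDT721_722_723_auxiliaryCurve
    (CDT_theorem_7_2_1_of_langlands_tunnell_of_lift_of_three_facts hLT hES hF hC hlift3)
    (CDT_theorem_7_2_2_of_lift_of_three_facts hES hF hC hlift5) h723 hE

/-- **Granted everything else its printed proof invokes, `CDT_theorem_7_1_2` is equivalent to
the `3`-adic lifting statement of p. 553**: with Langlands–Tunnell, Eichler–Shimura, Faltings,
Carayol, the `5`-adic lifting statement, Lemma 7.2.3 and the `3`–`5` switch granted, Theorem 7.1.2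
holds iff `lift₃` does (`CDT_theorem_7_1_2_iff_CDT721` of `CDTTheorem712ConductorStepProofs` —
7.1.2 versus its "weaker version" 7.2.1 — composed with
`CDT_theorem_7_2_1_iff_lift_of_langlands_tunnell_of_three_facts`).
[cite: ConradDiamondTaylor1999, §7.2 (pp. 553–556)] -/
theorem CDT_theorem_7_1_2_iff_lift_three_of_langlands_tunnell_of_lift_five_of_7_2_3_of_switch_of_three_facts
    (hLT : ∀ σ : FramedArtinRep ℚ 2, langlands_tunnell σ)
    (hES : eichlerShimuraConstruction)
    (hF : WeierstrassCurve.isIsogenous_iff_frobeniusTrace_eq)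
    (hC : ∀ (N : ℕ) [NeZero N], IsNewformOf.level_eq_conductorNorm (N := N))
    (hlift5 : ∀ (W : WeierstrassCurve ℚ) [W.IsElliptic] (ρ : ModPGaloisRep ℚ (ZMod 5) 2),
      W.IsTorsionGaloisRep 5 ρ → ρ.IsAbsIrreducibleOverSqrt 5 → ρ.IsModular →
      W.IsModularGaloisRepTate 5)
    (h723 : CDT_lemma_7_2_3_isModular) (hsw : CDT_three_five_switch) :
    CDT_theorem_7_1_2 ↔
      ∀ (W : WeierstrassCurve ℚ) [W.IsElliptic] (ρ : ModPGaloisRep ℚ (ZMod 3) 2),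
        W.IsTorsionGaloisRep 3 ρ → ρ.IsAbsIrreducibleOverSqrt (-3) → ¬ 27 ∣ W.conductorNorm ℤ →
        ρ.IsModular → W.IsModularGaloisRepTate 3 :=
  (CDT_theorem_7_1_2_iff_CDT721 (CDT_theorem_7_2_2_of_lift_of_three_facts hES hF hC hlift5) h723
      hsw).trans
    (CDT_theorem_7_2_1_iff_lift_of_langlands_tunnell_of_three_facts hLT hES hF hC)

/-! ## Downstream: CDT Theorem 7.2.4, BCDT Theorems B and A on the same inputs -/

/-- **CDT Theorem 7.2.4** ("`ρ̄_{E,5}` modular or `ρ̄_{E,5}|_{ℚ(√5)}` not absolutely irreducible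
⇒ `E` modular"; p. 556: "immediate from Theorem 7.1.2 [and Theorem 7.2.2]") **from the two lifting
statements, Langlands–Tunnell, Lemma 7.2.3, the switch and the three classical facts**:
`CDT_theorem_7_2_4_of_CDT712_722` (`CDTTheorem712ConductorStepProofs`, hidden lemma `27 ∣ N_E ⇒
ρ̄_{E,5}|_{ℚ(√5)}` absolutely irreducible proved there) on
`CDT_theorem_7_1_2_of_langlands_tunnell_of_lifts_of_7_2_3_of_switch_of_three_facts` and
`CDT_theorem_7_2_2_of_lift_of_three_facts`. [cite: ConradDiamondTaylor1999, Thm. 7.2.4] -/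
theorem CDT_theorem_7_2_4_of_langlands_tunnell_of_lifts_of_7_2_3_of_switch_of_three_facts
    (hLT : ∀ σ : FramedArtinRep ℚ 2, langlands_tunnell σ)
    (hES : eichlerShimuraConstruction)
    (hF : WeierstrassCurve.isIsogenous_iff_frobeniusTrace_eq)
    (hC : ∀ (N : ℕ) [NeZero N], IsNewformOf.level_eq_conductorNorm (N := N))
    (hlift3 : ∀ (W : WeierstrassCurve ℚ) [W.IsElliptic] (ρ : ModPGaloisRep ℚ (ZMod 3) 2),
      W.IsTorsionGaloisRep 3 ρ → ρ.IsAbsIrreducibleOverSqrt (-3) → ¬ 27 ∣ W.conductorNorm ℤ →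
      ρ.IsModular → W.IsModularGaloisRepTate 3)
    (hlift5 : ∀ (W : WeierstrassCurve ℚ) [W.IsElliptic] (ρ : ModPGaloisRep ℚ (ZMod 5) 2),
      W.IsTorsionGaloisRep 5 ρ → ρ.IsAbsIrreducibleOverSqrt 5 → ρ.IsModular →
      W.IsModularGaloisRepTate 5)
    (h723 : CDT_lemma_7_2_3_isModular) (hsw : CDT_three_five_switch) : CDT_theorem_7_2_4 :=
  CDT_theorem_7_2_4_of_CDT712_722
    (CDT_theorem_7_1_2_of_langlands_tunnell_of_lifts_of_7_2_3_of_switch_of_three_facts hLT hES hF hC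
      hlift3 hlift5 h723 hsw)
    (CDT_theorem_7_2_2_of_lift_of_three_facts hES hF hC hlift5)

/-- **BCDT Theorem B = Theorem 2.2.1 from its wild case, the auxiliary curve, Langlands–Tunnell,
the `3`-adic lifting statement and the three classical facts**: `theoremB_of_wild_auxiliaryCurve_CDT721`
(`CDTTheorem712ConductorStepProofs`: the tame case "`E` is modular by Theorem 7.2.1 of [CDT]" with
`27 ∤ N_E` proved from tameness) with CDT Thm. 7.2.1 unfolded by
`CDT_theorem_7_2_1_of_langlands_tunnell_of_lift_of_three_facts`.  Trust base of Theorem B inside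
the tree after this file: {wild case (`exists_isTorsionGaloisRep_and_isModular_of_not_isTamelyRamifiedAbove`),
auxiliary curve (`exists_isTorsionGaloisRep_five_and_surjective_three`), `langlands_tunnell`,
Eichler–Shimura, Faltings, Carayol} plus `lift₃`. [cite: BCDTJAMS2001, Theorem 2.2.1 (proof, §2.2)] -/
theorem theoremB_of_wild_auxiliaryCurve_langlands_tunnell_lift_three_facts
    (hW : exists_isTorsionGaloisRep_and_isModular_of_not_isTamelyRamifiedAbove)
    (hE : exists_isTorsionGaloisRep_five_and_surjective_three)
    (hLT : ∀ σ : FramedArtinRep ℚ 2, langlands_tunnell σ)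
    (hES : eichlerShimuraConstruction)
    (hF : WeierstrassCurve.isIsogenous_iff_frobeniusTrace_eq)
    (hC : ∀ (N : ℕ) [NeZero N], IsNewformOf.level_eq_conductorNorm (N := N))
    (hlift3 : ∀ (W : WeierstrassCurve ℚ) [W.IsElliptic] (ρ : ModPGaloisRep ℚ (ZMod 3) 2),
      W.IsTorsionGaloisRep 3 ρ → ρ.IsAbsIrreducibleOverSqrt (-3) → ¬ 27 ∣ W.conductorNorm ℤ →
      ρ.IsModular → W.IsModularGaloisRepTate 3) :
    theoremB :=
  theoremB_of_wild_auxiliaryCurve_CDT721 hW hE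
    (CDT_theorem_7_2_1_of_langlands_tunnell_of_lift_of_three_facts hLT hES hF hC hlift3)

/-- **The Modularity Theorem (BCDT Theorem A, `exists_isNewformOf`) along the CDT–BCDT route from
its printed deep inputs, with both CDT theorems unfolded into applications of Theorem 7.1.1.**
Granted (i) the wild case of BCDT Thm. 2.2.1, (ii) the Shepherd-Barron–Taylor auxiliary curve,
(iii) Langlands–Tunnell, (iv) the `3`-adic lifting statement `lift₃` (CDT Thm. 7.2.1, proof),
(v) the `5`-adic lifting statement `lift₅` (CDT Thm. 7.2.2, proof), (vi) the modularity conclusion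
of CDT Lemma 7.2.3 (Elkies), and (vii) Eichler–Shimura, Faltings, Carayol, every elliptic curve
over `ℚ` is modular: `exists_isNewformOf_of_wild_auxiliaryCurve_CDT721_722_723`
(`CDTTheorem712ConductorStepProofs`) with 7.2.1 and 7.2.2 unfolded. [cite: BCDTJAMS2001, Theorem A] -/
theorem exists_isNewformOf_of_wild_auxiliaryCurve_langlands_tunnell_lifts_723_three_facts
    (hW : exists_isTorsionGaloisRep_and_isModular_of_not_isTamelyRamifiedAbove)
    (hE : exists_isTorsionGaloisRep_five_and_surjective_three)
    (hLT : ∀ σ : FramedArtinRep ℚ 2, langlands_tunnell σ)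
    (hES : eichlerShimuraConstruction)
    (hF : WeierstrassCurve.isIsogenous_iff_frobeniusTrace_eq)
    (hC : ∀ (N : ℕ) [NeZero N], IsNewformOf.level_eq_conductorNorm (N := N))
    (hlift3 : ∀ (W : WeierstrassCurve ℚ) [W.IsElliptic] (ρ : ModPGaloisRep ℚ (ZMod 3) 2),
      W.IsTorsionGaloisRep 3 ρ → ρ.IsAbsIrreducibleOverSqrt (-3) → ¬ 27 ∣ W.conductorNorm ℤ →
      ρ.IsModular → W.IsModularGaloisRepTate 3)
    (hlift5 : ∀ (W : WeierstrassCurve ℚ) [W.IsElliptic] (ρ : ModPGaloisRep ℚ (ZMod 5) 2),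
      W.IsTorsionGaloisRep 5 ρ → ρ.IsAbsIrreducibleOverSqrt 5 → ρ.IsModular →
      W.IsModularGaloisRepTate 5)
    (h723 : CDT_lemma_7_2_3_isModular) : EllipticCurves.ModularForms.exists_isNewformOf :=
  exists_isNewformOf_of_wild_auxiliaryCurve_CDT721_722_723 hW hE
    (CDT_theorem_7_2_1_of_langlands_tunnell_of_lift_of_three_facts hLT hES hF hC hlift3)
    (CDT_theorem_7_2_2_of_lift_of_three_facts hES hF hC hlift5) h723

end Literature.NumberTheory.Automorphic.BCDT

namespace Literature.NumberTheory.Automorphic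

open GaloisRepresentations EllipticCurves.ModularForms

/-- **lang.S33 (the weak `a_p`-form of the Modularity Theorem) on the same inputs**: granted the
hypotheses of `BCDT.exists_isNewformOf_of_wild_auxiliaryCurve_langlands_tunnell_lifts_723_three_facts`,
every elliptic `E / ℚ` has a cusp form `f ∈ S₂(Γ₀(N))` with `a_p(f) = p + 1 - #E(𝔽_p)` for
`p ∤ N Δ_E` (`exists_cuspForm_coeff_eq_frobeniusTrace_of_exists_isNewformOf`, `LangWave0Proofs`).
[cite: BCDTJAMS2001, Theorem 2.2.2] -/
theorem exists_cuspForm_coeff_eq_frobeniusTrace_of_wild_auxiliaryCurve_langlands_tunnell_lifts_723_three_facts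
    (hW : BCDT.exists_isTorsionGaloisRep_and_isModular_of_not_isTamelyRamifiedAbove)
    (hE : BCDT.exists_isTorsionGaloisRep_five_and_surjective_three)
    (hLT : ∀ σ : FramedArtinRep ℚ 2, langlands_tunnell σ)
    (hES : eichlerShimuraConstruction)
    (hF : WeierstrassCurve.isIsogenous_iff_frobeniusTrace_eq)
    (hC : ∀ (N : ℕ) [NeZero N], IsNewformOf.level_eq_conductorNorm (N := N))
    (hlift3 : ∀ (W : WeierstrassCurve ℚ) [W.IsElliptic] (ρ : ModPGaloisRep ℚ (ZMod 3) 2),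
      W.IsTorsionGaloisRep 3 ρ → ρ.IsAbsIrreducibleOverSqrt (-3) → ¬ 27 ∣ W.conductorNorm ℤ →
      ρ.IsModular → W.IsModularGaloisRepTate 3)
    (hlift5 : ∀ (W : WeierstrassCurve ℚ) [W.IsElliptic] (ρ : ModPGaloisRep ℚ (ZMod 5) 2),
      W.IsTorsionGaloisRep 5 ρ → ρ.IsAbsIrreducibleOverSqrt 5 → ρ.IsModular →
      W.IsModularGaloisRepTate 5)
    (h723 : BCDT.CDT_lemma_7_2_3_isModular) : exists_cuspForm_coeff_eq_frobeniusTrace :=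
  exists_cuspForm_coeff_eq_frobeniusTrace_of_exists_isNewformOf
    (BCDT.exists_isNewformOf_of_wild_auxiliaryCurve_langlands_tunnell_lifts_723_three_facts hW hE hLT
      hES hF hC hlift3 hlift5 h723)

end Literature.NumberTheory.Automorphic

end
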